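import Summits.ResolutionOfSingularities.ResolutionOfSingularities.Theorems.PurelyInseparableDim4JointHereditaryCertCharts
import Summits.ResolutionOfSingularities.ResolutionOfSingularities.Theorems.PurelyInseparableDim4JointHereditaryRoot
import HarnessLib

/-!
# Purely inseparable four-folds: the FIRST CERTIFICATE WITH HEREDITARY WAITING — `F = x₁x₂^{p−1}x₃x₄ + x₁^{2p−2}x₂ + x₂^{p+1}`
# resolved through the v3-H root theorem (brick S3 (c) «joint point∘coordinate chains», part 67; cell `res-dim4-pi`)

[OURS · counted 0] (D-0157 DOOR 2; host item stmt-ResolutionOfSingularities-16155, helper). Nothing here proves resolution of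
singularities in dimension ≥ 4 / characteristic `p`. UNCONDITIONAL for every prime `p ≥ 3`: the marked ideal `((z^p + F)·𝒪, ∅, p)` on
`𝔸⁵_K` (`K = K̄`) has a marked resolution, certified through `exists_isMarkedResolution_hereditary_root_hosts` (part 66) with the
combinatorial tree ROOT HOST `V(z, x₁, x₂)` → CHILD `(x₁, 0, {y₁, y₂, y₃})` hosting the HEREDITARY waiting entry `(y₃, 0, {y₁, y₂, y₄})`
(the order-`p` locus inside `E₁` is the cross of two curves) → waiting KID → dead (parts 67a/67b). This is the first non-vacuity witness
of the v3-H chain 58–66: a configuration the v3-lite chain (children born with empty waiting sets) could not certify.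

* **`exists_isMarkedResolution_inst₁₇`**. AI-produced formalisation, weaker than expert review.
bears_on: LADDER-RESOLUTION:D157-DOOR2 (res-dim4-pi · S3 (c) v3-H certificate).
-/

set_option linter.dupNamespace false -- D-0017: single-problem summit path `Summit.<S>.<S>.…` by design

noncomputable section

open MvPolynomial Finset CategoryTheory AlgebraicGeometry Opposite TopologicalSpace

namespace Summit.ResolutionOfSingularities.ResolutionOfSingularities.Theorems.PIDim4

open Literature.AlgebraicGeometry.Resolution
open Literature.AlgebraicGeometry.Resolution.Hauser2010
open Literature.AlgebraicGeometry.Resolution.AffinePointBlowup (P A γ coord Wtop ξ)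

namespace Equimultiple

section Instance₁₇

variable {K : Type} [Field K] {p : ℕ} [hp : Fact p.Prime] [CharP K p]

/-- **HEREDITARY WAITING, CERTIFIED** (`p ≥ 3`). See the module docstring.
[cite: BierstoneGrigorievMilmanWlodarczyk2011, Def. 3.1.3] [cite: HauserPerlega2019PRIMS, §2 (permissible centres P = (z, x_i : i ∈ Γ))]
[cite: Hauser2010, §F (equiconstant points)] -/
theorem exists_isMarkedResolution_inst₁₇ [IsAlgClosed K] [DecidableEq K] (hp3 : 3 ≤ p) :
    ∃ (X' : Scheme.{0}) (ρ : X' ⟶ P 4 K) (M' : MarkedIdeal X'),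
      IsMarkedResolution (⟨hypSheaf p (X 0 * X 1 ^ (p - 1) * X 2 * X 3 + X 0 ^ (2 * p - 2) * X 1 + X 1 ^ (p + 1) :
        MvPolynomial (Fin 4) K), [], p⟩ : MarkedIdeal (P 4 K)) ρ M' := by
  classical
  have hp1 : 1 ≤ p := hp.out.one_lt.le
  set F : MvPolynomial (Fin 4) K := X 0 * X 1 ^ (p - 1) * X 2 * X 3 + X 0 ^ (2 * p - 2) * X 1 + X 1 ^ (p + 1) with hFdef
  -- centres, entries, tables
  set S₀ : Finset (Fin 4) := {0, 1} with hS₀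
  set S₁ : Finset (Fin 4) := {0, 1, 2} with hS₁
  set S₂ : Finset (Fin 4) := {0, 1, 3} with hS₂
  have h01 : S₁ ≠ S₀ := by rw [hS₀, hS₁]; decide
  have h02 : S₂ ≠ S₀ := by rw [hS₀, hS₂]; decide
  have h12 : S₂ ≠ S₁ := by rw [hS₁, hS₂]; decide
  set e₀ : Fin 4 × (Fin 4 → K) × Finset (Fin 4) := ((0 : Fin 4), (0 : Fin 4 → K), S₁) with he₀
  set wt₀ : Fin 4 × (Fin 4 → K) × Finset (Fin 4) := ((2 : Fin 4), (0 : Fin 4 → K), S₂) with hwt₀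
  let plan : State K → Finset (Fin 4) → Finset (Fin 4 × (Fin 4 → K) × Finset (Fin 4)) := fun _ S => if S = S₀ then {e₀} else ∅
  let wplan : State K → Finset (Fin 4) → Finset (Fin 4 × (Fin 4 → K) × Finset (Fin 4)) := fun _ S => if S = S₁ then {wt₀} else ∅
  let leaves : State K → Finset (Fin 4) → Finset (Fin 4 × (Fin 4 → K)) := fun _ _ => ∅
  have hplan₀ : ∀ s : State K, plan s S₀ = {e₀} := fun s => if_pos rfl
  have hplan₁ : ∀ s : State K, plan s S₁ = ∅ := fun s => if_neg h01
  have hplan₂ : ∀ s : State K, plan s S₂ = ∅ := fun s => if_neg h02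
  have hwplan₀ : ∀ s : State K, wplan s S₀ = ∅ := fun s => if_neg h01.symm
  have hwplan₁ : ∀ s : State K, wplan s S₁ = {wt₀} := fun s => if_pos rfl
  have hwplan₂ : ∀ s : State K, wplan s S₂ = ∅ := fun s => if_neg h12
  have hP : ∀ (s : State K) (S : Finset (Fin 4)), plan ((s, S) : State K × Finset (Fin 4)).1 ((s, S) : State K × Finset (Fin 4)).2 =
      plan s S := fun _ _ => rfl
  have hW : ∀ (s : State K) (S : Finset (Fin 4)), wplan ((s, S) : State K × Finset (Fin 4)).1 ((s, S) : State K × Finset (Fin 4)).2 =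
      wplan s S := fun _ _ => rfl
  -- the states
  set s₀ : State K := ⟨F, 0, ∅⟩ with hs₀
  set s₁ : State K := CentreBlowup.step p S₀ 0 (0 : Fin 4 → K) s₀ with hs₁
  set s₂ : State K := CentreBlowup.step p S₁ 2 (0 : Fin 4 → K) s₁ with hs₂
  have hs₀F : s₀.F = X 0 * X 1 ^ (p - 1) * X 2 * X 3 + X 0 ^ (2 * p - 2) * X 1 + X 1 ^ (p + 1) := rfl
  have hs₁F : s₁.F = C 1 * (X 0 ^ 0 * X 1 ^ (p - 1) * X 2 ^ 1 * X 3 ^ 1) + C 1 * (X 0 ^ (p - 1) * X 1 ^ 1 * X 2 ^ 0 * X 3 ^ 0) +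
      C 1 * (X 0 ^ 1 * X 1 ^ (p + 1) * X 2 ^ 0 * X 3 ^ 0) := step_S0_hcert hp3 s₀ hs₀F
  have hs₂F : s₂.F = C 1 * (X 0 ^ 0 * X 1 ^ (p - 1) * X 2 ^ 0 * X 3 ^ 1) + C 1 * (X 0 ^ (p - 1) * X 1 ^ 1 * X 2 ^ 0 * X 3 ^ 0) +
      C 1 * (X 0 ^ 1 * X 1 ^ (p + 1) * X 2 ^ 2 * X 3 ^ 0) := step_U2_hcert hp3 s₁ hs₁F
  -- the edges
  have hE₀ : ∀ q', HEdge p plan wplan q' (s₀, S₀) ↔ q' = (s₁, S₁) := by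
    intro q'
    constructor
    · rintro (⟨e, he, rfl⟩ | ⟨wt, hwt, -⟩)
      · rw [hP, hplan₀ s₀, Finset.mem_singleton] at he; rw [he]
      · rw [hW, hwplan₀ s₀] at hwt; exact absurd hwt (Finset.notMem_empty wt)
    · rintro rfl; exact Or.inl ⟨e₀, by rw [hP, hplan₀ s₀]; exact Finset.mem_singleton_self _, rfl⟩
  have hE₁ : ∀ q', HEdge p plan wplan q' (s₁, S₁) ↔ q' = (s₂, S₂) := by
    intro q'
    constructor
    · rintro (⟨e, he, -⟩ | ⟨wt, hwt, rfl⟩)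
      · rw [hP, hplan₁ s₁] at he; exact absurd he (Finset.notMem_empty e)
      · rw [hW, hwplan₁ s₁, Finset.mem_singleton] at hwt; rw [hwt]
    · rintro rfl; exact Or.inr ⟨wt₀, by rw [hW, hwplan₁ s₁]; exact Finset.mem_singleton_self _, rfl⟩
  have hE₂ : ∀ q', ¬ HEdge p plan wplan q' (s₂, S₂) := by
    rintro q' (⟨e, he, -⟩ | ⟨wt, hwt, -⟩)
    · rw [hP, hplan₂ s₂] at he; exact absurd he (Finset.notMem_empty e)
    · rw [hW, hwplan₂ s₂] at hwt; exact absurd hwt (Finset.notMem_empty wt)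
  have hreach₂ : ∀ q, Relation.ReflTransGen (fun a e : State K × Finset (Fin 4) => HEdge p plan wplan e a) (s₂, S₂) q →
      q = (s₂, S₂) := by
    intro q hq
    induction hq with
    | refl => rfl
    | tail _ h ih => subst ih; exact absurd h (hE₂ _)
  have hreach₁ : ∀ q, Relation.ReflTransGen (fun a e : State K × Finset (Fin 4) => HEdge p plan wplan e a) (s₁, S₁) q →
      q = (s₁, S₁) ∨ q = (s₂, S₂) := by
    intro q hq
    induction hq with
    | refl => exact Or.inl rfl
    | tail _ h ih =>
      rcases ih with rfl | rfl
      · exact Or.inr ((hE₁ _).mp h)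
      · exact absurd h (hE₂ _)
  have hreach₀ : ∀ q, Relation.ReflTransGen (fun a e : State K × Finset (Fin 4) => HEdge p plan wplan e a) (s₀, S₀) q →
      q = (s₀, S₀) ∨ q = (s₁, S₁) ∨ q = (s₂, S₂) := by
    intro q hq
    induction hq with
    | refl => exact Or.inl rfl
    | tail _ h ih =>
      rcases ih with rfl | rfl | rfl
      · exact Or.inr (Or.inl ((hE₀ _).mp h))
      · exact Or.inr (Or.inr ((hE₁ _).mp h))
      · exact absurd h (hE₂ _)
  have hacc₂ : Acc (fun q' q : State K × Finset (Fin 4) => HEdge p plan wplan q' q) (s₂, S₂) :=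
    Acc.intro _ fun q' h => absurd h (hE₂ q')
  have hacc₁ : Acc (fun q' q : State K × Finset (Fin 4) => HEdge p plan wplan q' q) (s₁, S₁) :=
    Acc.intro _ fun q' h => by rw [(hE₁ q').mp h]; exact hacc₂
  have hacc₀ : Acc (fun q' q : State K × Finset (Fin 4) => HEdge p plan wplan q' q) (s₀, S₀) :=
    Acc.intro _ fun q' h => by rw [(hE₀ q').mp h]; exact hacc₁
  -- membership helpers
  have hm0S₀ : (0 : Fin 4) ∈ S₀ := by rw [hS₀]; decide
  have hemp : ∀ {α : Type} (x : α) (P : Prop), x ∈ (∅ : Finset α) → P := fun x P hx => absurd hx (Finset.notMem_empty x)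
  -- the three blocks
  have hblock₂ : BlockH p plan leaves wplan (s₂, S₂) := by
    refine ⟨fun e he => hemp e _ (by rw [hP, hplan₂ s₂] at he; exact he), fun e he => hemp e _ (by rw [hP, hplan₂ s₂] at he; exact he),
      fun l hl => hemp l _ hl, fun wt hwt => hemp wt _ (by rw [hW, hwplan₂ s₂] at hwt; exact hwt), fun wt hwt => hemp wt _ (by rw [hW, hwplan₂ s₂] at hwt; exact hwt),
      fun e he => hemp e _ (by rw [hP, hplan₂ s₂] at he; exact he), fun e he => hemp e _ (by rw [hP, hplan₂ s₂] at he; exact he),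
      fun wt hwt => hemp wt _ (by rw [hW, hwplan₂ s₂] at hwt; exact hwt), fun e he => hemp e _ (by rw [hP, hplan₂ s₂] at he; exact he),
      fun e he => hemp e _ (by rw [hP, hplan₂ s₂] at he; exact he), fun e he => hemp e _ (by rw [hP, hplan₂ s₂] at he; exact he), fun j' b' hj' hb' _ heq => ?_⟩
    exfalso
    change j' ∈ ({0, 1, 3} : Finset (Fin 4)) at hj'
    rcases Finset.mem_insert.mp hj' with rfl | hj'
    · exact not_isEquimultiplePoint_V0_hcert hp3 s₂ hs₂F hb' heq
    rcases Finset.mem_insert.mp hj' with rfl | hj'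
    · exact not_isEquimultiplePoint_V1_hcert s₂ hs₂F heq
    · rw [Finset.mem_singleton] at hj'; subst hj'
      exact not_isEquimultiplePoint_V3_hcert hp3 s₂ hs₂F hb' heq
  have hblock₁ : BlockH p plan leaves wplan (s₁, S₁) := by
    refine ⟨fun e he => hemp e _ (by rw [hP, hplan₁ s₁] at he; exact he), fun e he => hemp e _ (by rw [hP, hplan₁ s₁] at he; exact he),
      fun l hl => hemp l _ hl, fun wt hwt => ?_, fun wt hwt wt' hwt' hne => ?_, fun e he => hemp e _ (by rw [hP, hplan₁ s₁] at he; exact he),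
      fun e he => hemp e _ (by rw [hP, hplan₁ s₁] at he; exact he), fun wt hwt q' hq' => ?_, fun e he => hemp e _ (by rw [hP, hplan₁ s₁] at he; exact he),
      fun e he => hemp e _ (by rw [hP, hplan₁ s₁] at he; exact he), fun e he => hemp e _ (by rw [hP, hplan₁ s₁] at he; exact he), fun j' b' hj' hb' hnorm heq => ?_⟩
    · -- W1 for the hereditary entry
      change wt ∈ wplan s₁ S₁ at hwt
      rw [hwplan₁ s₁, Finset.mem_singleton] at hwt
      rw [hwt]
      refine ⟨by show (2 : Fin 4) ∈ S₁; rw [hS₁]; decide, fun i _ => rfl, fun i _ => rfl,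
        by show S₁.erase 2 ⊆ S₂; rw [hS₁, hS₂]; decide, by show (2 : Fin 4) ∉ S₂; rw [hS₂]; decide, ?_⟩
      show IsPermissibleCentre p S₂ (PointBlowup.translate (0 : Fin 4 → K) s₁.F)
      rw [PointBlowup.translate_zero, hs₁F, hS₂]
      exact isPermissibleCentre_V_F1_hcert hp1
    · change wt ∈ wplan s₁ S₁ at hwt; change wt' ∈ wplan s₁ S₁ at hwt'
      rw [hwplan₁ s₁, Finset.mem_singleton] at hwt hwt'
      exact absurd (hwt.trans hwt'.symm) hne
    · -- H0: nothing at or below the kid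
      change wt ∈ wplan s₁ S₁ at hwt
      rw [hwplan₁ s₁, Finset.mem_singleton] at hwt
      rw [hwt] at hq'
      rw [hreach₂ q' hq']
      exact hwplan₂ s₂
    · -- the cover at the child: charts y₁, y₂ dead; on y₃ the origin, covered by the hereditary entry
      change j' ∈ ({0, 1, 2} : Finset (Fin 4)) at hj'
      rcases Finset.mem_insert.mp hj' with rfl | hj'
      · exact absurd heq (not_isEquimultiplePoint_U0_hcert hp3 s₁ hs₁F hb')
      rcases Finset.mem_insert.mp hj' with rfl | hj'
      · exact absurd heq (not_isEquimultiplePoint_U1_hcert hp3 s₁ hs₁F)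
      rw [Finset.mem_singleton] at hj'; subst hj'
      have hb0 : b' 0 = 0 := hnorm 0 (by show (0 : Fin 4) ∈ S₁; rw [hS₁]; decide) (by decide)
      have hb1 : b' 1 = 0 := hnorm 1 (by show (1 : Fin 4) ∈ S₁; rw [hS₁]; decide) (by decide)
      have hb3 : b' 3 = 0 := cases_U2_hcert hp3 s₁ hs₁F heq hb0
      refine Or.inr (Or.inl ⟨wt₀, by change wt₀ ∈ wplan s₁ S₁; rw [hwplan₁ s₁]; exact Finset.mem_singleton_self _, rfl, fun i hi => ?_⟩)
      change i ∈ ({0, 1, 3} : Finset (Fin 4)) at hi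
      rcases Finset.mem_insert.mp hi with rfl | hi
      · exact hb0
      rcases Finset.mem_insert.mp hi with rfl | hi
      · exact hb1
      · rw [Finset.mem_singleton] at hi; subst hi; exact hb3
  have hblock₀ : BlockH p plan leaves wplan (s₀, S₀) := by
    refine ⟨fun e he => ?_, fun e he e' he' hne => ?_, fun l hl => hemp l _ hl, fun wt hwt => hemp wt _ (by rw [hW, hwplan₀ s₀] at hwt; exact hwt),
      fun wt hwt => hemp wt _ (by rw [hW, hwplan₀ s₀] at hwt; exact hwt), fun e he wt hwt => hemp wt _ (by rw [hW, hwplan₀ s₀] at hwt; exact hwt), fun e he wt hwt => ?_,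
      fun wt hwt => hemp wt _ (by rw [hW, hwplan₀ s₀] at hwt; exact hwt), fun e he wt hwt e' he' hne => ?_, fun e he wt hwt wt₁ hwt₁ => hemp wt₁ _ (by rw [hW, hwplan₀ s₀] at hwt₁; exact hwt₁),
      fun e he wt hwt e' he' wt' hwt' hne => ?_, fun j' b' hj' hb' hnorm heq => ?_⟩
    · -- P1 for the child
      change e ∈ plan s₀ S₀ at he
      rw [hplan₀ s₀, Finset.mem_singleton] at he
      rw [he]
      refine ⟨hm0S₀, rfl, by show S₀ ⊆ S₁; rw [hS₀, hS₁]; decide, isEquimultiplePoint_S0_zero_hcert hp3 s₀ hs₀F, ?_⟩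
      show IsPermissibleCentre p S₁ (CentreBlowup.step p S₀ 0 (0 : Fin 4 → K) s₀).F
      rw [← hs₁, hs₁F, hS₁]
      exact isPermissibleCentre_U_F1_hcert hp1
    · change e ∈ plan s₀ S₀ at he; change e' ∈ plan s₀ S₀ at he'
      rw [hplan₀ s₀, Finset.mem_singleton] at he he'
      exact absurd (he.trans he'.symm) hne
    · -- H1: the hereditary side conditions
      change e ∈ plan s₀ S₀ at he
      rw [hplan₀ s₀, Finset.mem_singleton] at he
      rw [he] at hwt ⊢
      change wt ∈ wplan s₁ S₁ at hwt
      rw [hwplan₁ s₁, Finset.mem_singleton] at hwt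
      rw [hwt]
      exact ⟨by show (2 : Fin 4) ∉ S₀; rw [hS₀]; decide, by show (0 : Fin 4) ∈ S₂; rw [hS₂]; decide, rfl⟩
    · change e ∈ plan s₀ S₀ at he; change e' ∈ plan s₀ S₀ at he'
      rw [hplan₀ s₀, Finset.mem_singleton] at he he'
      exact absurd (he'.trans he.symm) hne
    · change e ∈ plan s₀ S₀ at he; change e' ∈ plan s₀ S₀ at he'
      rw [hplan₀ s₀, Finset.mem_singleton] at he he'
      rw [he] at hwt hne; rw [he'] at hwt' hne
      change wt ∈ wplan s₁ S₁ at hwt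
      change wt' ∈ wplan s₁ S₁ at hwt'
      rw [hwplan₁ s₁, Finset.mem_singleton] at hwt hwt'
      rw [hwt, hwt'] at hne
      exact absurd rfl hne
    · -- the FOUR-WAY cover at the root: chart x₂ dead; chart x₁: child or hereditary region
      change j' ∈ ({0, 1} : Finset (Fin 4)) at hj'
      rcases Finset.mem_insert.mp hj' with rfl | hj'
      · obtain ⟨hb1, hb23⟩ := cases_S0_hcert hp3 s₀ hs₀F heq hb'
        rcases hb23 with hb2 | hb3
        · refine Or.inl ⟨e₀, by change e₀ ∈ plan s₀ S₀; rw [hplan₀ s₀]; exact Finset.mem_singleton_self _, rfl, fun i hi => ?_⟩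
          change i ∈ ({0, 1, 2} : Finset (Fin 4)) at hi
          rcases Finset.mem_insert.mp hi with rfl | hi
          · exact hb'
          rcases Finset.mem_insert.mp hi with rfl | hi
          · exact hb1
          · rw [Finset.mem_singleton] at hi; subst hi; exact hb2
        · refine Or.inr (Or.inr (Or.inl ⟨e₀, by change e₀ ∈ plan s₀ S₀; rw [hplan₀ s₀]; exact Finset.mem_singleton_self _, rfl, wt₀,
            by change wt₀ ∈ wplan s₁ S₁; rw [hwplan₁ s₁]; exact Finset.mem_singleton_self _, fun i hi => ?_⟩))
          change i ∈ ({0, 1, 3} : Finset (Fin 4)) at hi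
          change b' i = (0 : Fin 4 → K) i + (0 : Fin 4 → K) i
          rw [Pi.zero_apply, add_zero]
          rcases Finset.mem_insert.mp hi with rfl | hi
          · exact hb'
          rcases Finset.mem_insert.mp hi with rfl | hi
          · exact hb1
          · rw [Finset.mem_singleton] at hi; subst hi; exact hb3
      · rw [Finset.mem_singleton] at hj'; subst hj'
        exact absurd heq (not_isEquimultiplePoint_S1_hcert hp3 s₀ hs₀F hb')
  -- the root: no parameter off the host
  have hstate : ∀ bS ∈ ({((0 : Fin 4 → K), S₀)} : Finset ((Fin 4 → K) × Finset (Fin 4))),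
      (⟨deletePthPowers p (PointBlowup.translate bS.1 F), 0, ∅⟩ : State K) = s₀ := by
    intro bS hbS
    rw [Finset.mem_singleton] at hbS
    subst hbS
    show (⟨deletePthPowers p (PointBlowup.translate (0 : Fin 4 → K) F), 0, ∅⟩ : State K) = s₀
    rw [PointBlowup.translate_zero, hFdef,
      Literature.Barriers.ResolutionOfSingularities.HauserPerlega.deletePthPowers_eq_self (isClean_hcert hp3)]
  have hoff : ∀ b' : Fin 4 → K, (∀ d : Fin 4 →₀ ℕ, d ≠ 0 → d.degree < p → coeff d (PointBlowup.translate b' F) = 0) →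
      (∀ bS ∈ ({((0 : Fin 4 → K), S₀)} : Finset ((Fin 4 → K) × Finset (Fin 4))), ¬ ∀ i ∈ bS.2, b' i = bS.1 i) → False := by
    intro b' H hno
    obtain ⟨hb0, hb1⟩ := roots_hcert hp3 b' H
    refine hno _ (Finset.mem_singleton_self _) fun i hi => ?_
    change i ∈ ({0, 1} : Finset (Fin 4)) at hi
    rcases Finset.mem_insert.mp hi with rfl | hi
    · exact hb0
    · rw [Finset.mem_singleton] at hi; subst hi; exact hb1
  refine exists_isMarkedResolution_hereditary_root_hosts (p := p) F (hcert_ne_zero hp3) (isClean_hcert hp3) plan leaves wplan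
    {((0 : Fin 4 → K), S₀)} (fun _ => s₀) (fun bS hbS => (hstate bS hbS).symm) (fun bS hbS => ?_) (fun bS hbS bS' hbS' hbb => ?_)
    (fun bS hbS bS' hbS' hbb => ?_) (fun bS hbS bS' hbS' hbb => ?_) ?_ (fun b' H hno _ => (hoff b' H hno).elim)
  · -- the host's data
    rw [Finset.mem_singleton] at hbS
    subst hbS
    exact ⟨by rw [hs₀F, hS₀]; exact isPermissibleCentre_S_hcert hp1, fun q hq => by
      rcases hreach₀ q hq with rfl | rfl | rfl
      · exact hblock₀
      · exact hblock₁
      · exact hblock₂, hacc₀⟩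
  all_goals try (rw [Finset.mem_singleton] at hbS hbS'; exact absurd (hbS.trans hbS'.symm) hbb)
  · -- no isolated root points
    exact Set.Finite.subset Set.finite_empty fun b' hb => (hoff b' hb.1 hb.2.1).elim

end Instance₁₇

end Equimultiple

end Summit.ResolutionOfSingularities.ResolutionOfSingularities.Theorems.PIDim4

end
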